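import Summits.ValiantsHypothesis.ValiantsHypothesis.Theorems.BarrierLeverChowThinRowsForestPrelims

/-!
# Route BarrierLever — item `ChowHitsThinRowPartitionMinors` (stmt-ValiantsHypothesis-20195):
# prelims for the pair layer on FOREST layouts × arbitrary columns, II — the INCIDENCE determinant

Helper file (`--supports stmt-ValiantsHypothesis-20195`; cell valiant-natproofs, rung V4, 𝒟-side of
door (c); prover seat val-np-p2 gen 6).  Closes NO item; imports `…ChowThinRowsForestPrelims`
(val-np-p2 g6; hence val-np-p7 g4's `…ChowThinRowsScaledForms`: `coeff_leaveOneOutG`,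
`coeff_tinvG`); no route file; no definitions.

**Theorem `forest_leadingMatrix_det_ne_zero`.**  The unperturbed ("leading") matrix of the
omnibus design on a forest layout is nonsingular.  Data: rows `u` of size `≤ 2` with `u i₀ = ∅`,
representatives `rep i ∈ u i` (`i ≠ i₀`, injective) with the FOREST CERTIFICATE (a singleton row
meets no pair row; if `rep i'` is the non-representative endpoint of a pair row `i` then
`rank (rep i') < rank (rep i)`); an injective down-closed family `U` (the monomial basis of the
columns) inside the index family `PT` of the `y`-forms `φ⁰_V = 1 + Σ_c γ V c · y_c` (`γ V` supported
in `V`, `∏_{c∈V} γ V c ≠ 0`) whose matrix `B̃[i,j] = [U i ⊆ w j]·b(w j ∖ U i)` is nonsingular; a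
permutation `σ` with `U (σ i₀) = ∅`; labels `lab (rep i) = U (σ i)` taking values among the `U k`;
and the indicator `χ` of the representatives.  Conclusion: the matrix with row `i₀` equal to
`b(w j) = coeff_{y^{w j}} ∏_{PT} φ⁰` and row `i ≠ i₀` equal to `Σ_{a ∈ u i} χ a · coeff_{y^{w j}} ∏_{PT ∖ lab a} φ⁰`
(for a pair row: the SUM of the leave-one-out products of the labels of its representative
endpoints — the vertex–edge incidence pattern of the forest) has nonzero determinant.
Mechanism: it factors as `P · B̃` with `P[i,i'] = ρ_i(U i')`, `ρ_{i₀} = [· = ∅]`,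
`ρ_i = Σ_{a∈u i} χ a · t_{lab a}` (truncated inverses, `coeff_leaveOneOutG`); `v ↦ v·P` is injective:
collecting coefficients on the independent family `t_{U(σ k)}` (`tinvFamily_eq_zero`) leaves
`c i₀ = 0` and `c k + Σ_{pair rows i ∋ rep k, i ≠ k} c i = 0`, which forces `c = 0` by induction on
`rank` (children of a vertex have larger rank).

WHAT THIS IS NOT: the perturbed (actual) partition minor is treated in `…ForestAllColumns`;
nothing here on items 20172 / 19717, on crux stmt-ValiantsHypothesis-14610, or on `VP` versus `VNP`.
-/

set_option linter.dupNamespace false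

namespace Summit.ValiantsHypothesis.ValiantsHypothesis.Theorems.BarrierLever.ChowThinAll

open Finset MvPolynomial

/-- **The leading matrix of the omnibus design on a forest layout is nonsingular**: see the
module docstring. -/
theorem forest_leadingMatrix_det_ne_zero (h : ℕ) {r : ℕ} (u w : Fin r → Finset (Fin h))
    (hu2 : ∀ i, (u i).card ≤ 2) (i₀ : Fin r)
    (rep : Fin r → Fin h) (hrep : ∀ i, i ≠ i₀ → rep i ∈ u i)
    (hrinj : ∀ i i', i ≠ i₀ → i' ≠ i₀ → rep i = rep i' → i = i')
    (hoff : ∀ i i', i ≠ i₀ → (u i).card = 1 → (u i').card = 2 → Disjoint (u i) (u i'))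
    (rank : Fin h → ℕ)
    (hrank : ∀ i i', i ≠ i₀ → i' ≠ i₀ → (u i).card = 2 → (u i').card = 2 →
      rep i' ∈ u i → rep i' ≠ rep i → rank (rep i') < rank (rep i))
    (U : Fin r → Finset (Fin h)) (hUinj : Function.Injective U)
    (hUdown : ∀ i (S : Finset (Fin h)), S ⊆ U i → ∃ i', U i' = S)
    (PT : Finset (Finset (Fin h))) (hUPT : ∀ i, U i ∈ PT)
    (γ : Finset (Fin h) → Fin h → ℂ) (hγsupp : ∀ (V : Finset (Fin h)) (c : Fin h), c ∉ V → γ V c = 0)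
    (hγprod : ∀ V : Finset (Fin h), ∏ c ∈ V, γ V c ≠ 0)
    (hBt : (Matrix.of fun i j : Fin r => if U i ⊆ w j then
        coeff (∑ a ∈ (∅ : Finset (Fin h)), Finsupp.single (Fin.castAdd h a) 1 +
            ∑ c ∈ w j \ U i, Finsupp.single (Fin.natAdd h c) 1)
          (∏ V ∈ PT, (C 1 + ∑ a, C ((fun (_ : Fin h) (_ : Finset (Fin h)) => (0 : ℂ)) a V) *
            X (Fin.castAdd h a) + ∑ c, C (γ V c) * X (Fin.natAdd h c))) else 0).det ≠ 0)
    (σ : Fin r ≃ Fin r) (hσ0 : U (σ i₀) = ∅)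
    (lab : Fin h → Finset (Fin h)) (hlabrep : ∀ i, i ≠ i₀ → lab (rep i) = U (σ i))
    (hlabU : ∀ a, ∃ k, lab a = U k)
    (χ : Fin h → ℂ) (hχrep : ∀ i, i ≠ i₀ → χ (rep i) = 1)
    (hχ0 : ∀ a, (¬ ∃ i, i ≠ i₀ ∧ rep i = a) → χ a = 0) :
    (Matrix.of fun i j : Fin r =>
      if i = i₀ then coeff (∑ a ∈ (∅ : Finset (Fin h)), Finsupp.single (Fin.castAdd h a) 1 +
          ∑ c ∈ w j, Finsupp.single (Fin.natAdd h c) 1) (∏ V ∈ PT, (C 1 + ∑ a, C ((fun (_ : Fin h) (_ : Finset (Fin h)) => (0 : ℂ)) a V) *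
            X (Fin.castAdd h a) + ∑ c, C (γ V c) * X (Fin.natAdd h c)))
      else ∑ a ∈ u i, χ a * coeff (∑ a ∈ (∅ : Finset (Fin h)), Finsupp.single (Fin.castAdd h a) 1 +
          ∑ c ∈ w j, Finsupp.single (Fin.natAdd h c) 1) (∏ V' ∈ PT.erase (lab a), (C 1 + ∑ a, C ((fun (_ : Fin h) (_ : Finset (Fin h)) => (0 : ℂ)) a V') *
            X (Fin.castAdd h a) + ∑ c, C (γ V' c) * X (Fin.natAdd h c)))).det ≠ 0 := by
  classical
  have hlabPT : ∀ a, lab a ∈ PT := fun a => by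
    obtain ⟨k, hk⟩ := hlabU a
    rw [hk]
    exact hUPT k
  have hcard_pos : ∀ i, i ≠ i₀ → 1 ≤ (u i).card := fun i hi =>
    Finset.card_pos.mpr ⟨rep i, hrep i hi⟩
  have hsingrep : ∀ i c, i ≠ i₀ → u i = {c} → rep i = c := fun i c hi hc =>
    Finset.mem_singleton.mp (by rw [← hc]; exact hrep i hi)
  have hreppair : ∀ i k a, (u i).card = 2 → a ∈ u i → k ≠ i₀ → rep k = a → (u k).card = 2 := by
    intro i k a hi ha hk hka
    rcases Nat.lt_or_ge (u k).card 2 with hlt | hge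
    · exfalso
      have hc1 : (u k).card = 1 := by have := hcard_pos k hk; omega
      have hd := hoff k i hk hc1 hi
      exact Finset.disjoint_left.mp hd (by rw [← hka]; exact hrep k hk) ha
    · exact le_antisymm (hu2 k) hge
  -- the `y`-coefficients `b`, the leave-one-out coefficients, the truncated inverses
  obtain ⟨b, hb⟩ : ∃ b : Finset (Fin h) → ℂ, ∀ W', b W' = coeff (∑ a ∈ (∅ : Finset (Fin h)), Finsupp.single (Fin.castAdd h a) 1 +
          ∑ c ∈ W', Finsupp.single (Fin.natAdd h c) 1)
      (∏ V ∈ PT, (C 1 + ∑ a, C ((fun (_ : Fin h) (_ : Finset (Fin h)) => (0 : ℂ)) a V) *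
            X (Fin.castAdd h a) + ∑ c, C (γ V c) * X (Fin.natAdd h c))) := ⟨fun W' => _, fun _ => rfl⟩
  obtain ⟨LOO, hLOO⟩ : ∃ LOO : Finset (Fin h) → Fin r → ℂ, ∀ V j, LOO V j = coeff (∑ a ∈ (∅ : Finset (Fin h)), Finsupp.single (Fin.castAdd h a) 1 +
          ∑ c ∈ w j, Finsupp.single (Fin.natAdd h c) 1)
      (∏ V' ∈ PT.erase V, (C 1 + ∑ a, C ((fun (_ : Fin h) (_ : Finset (Fin h)) => (0 : ℂ)) a V') *
            X (Fin.castAdd h a) + ∑ c, C (γ V' c) * X (Fin.natAdd h c))) := ⟨fun V j => _, fun _ _ => rfl⟩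
  set tfun : Finset (Fin h) → Finset (Fin h) → ℂ := fun V X' =>
    if X' ⊆ V then (-1 : ℂ) ^ X'.card * (X'.card.factorial : ℂ) * ∏ c ∈ X', γ V c else 0 with htfun
  have hLOOt : ∀ V j, V ∈ PT → LOO V j = ∑ X' ∈ (w j).powerset, b (w j \ X') * tfun V X' := by
    intro V j hV
    rw [hLOO, coeff_leaveOneOutG γ PT V hV (hγsupp V) (w j)]
    refine Finset.sum_congr rfl fun X' _ => ?_
    rw [hb, coeff_tinvG]
  have htfun_supp : ∀ V X', tfun V X' ≠ 0 → X' ⊆ V := by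
    intro V X' hX
    by_contra hsub
    exact hX (by simp only [htfun, if_neg hsub])
  have htfun_empty : ∀ X', tfun ∅ X' = if X' = ∅ then 1 else 0 := by
    intro X'
    by_cases h0 : X' = ∅
    · subst h0
      simp [htfun]
    · have hns : ¬ X' ⊆ ∅ := fun hs' => h0 (Finset.subset_empty.mp hs')
      simp only [htfun, if_neg hns, if_neg h0]
  -- the matrix in terms of `b` and `LOO`, and the row polynomials `ρ`
  set A : Matrix (Fin r) (Fin r) ℂ := Matrix.of fun i j =>
    if i = i₀ then b (w j) else ∑ a ∈ u i, χ a * LOO (lab a) j with hA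
  have hAeq : (Matrix.of fun i j : Fin r =>
      if i = i₀ then coeff (∑ a ∈ (∅ : Finset (Fin h)), Finsupp.single (Fin.castAdd h a) 1 +
          ∑ c ∈ w j, Finsupp.single (Fin.natAdd h c) 1) (∏ V ∈ PT, (C 1 + ∑ a, C ((fun (_ : Fin h) (_ : Finset (Fin h)) => (0 : ℂ)) a V) *
            X (Fin.castAdd h a) + ∑ c, C (γ V c) * X (Fin.natAdd h c)))
      else ∑ a ∈ u i, χ a * coeff (∑ a ∈ (∅ : Finset (Fin h)), Finsupp.single (Fin.castAdd h a) 1 +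
          ∑ c ∈ w j, Finsupp.single (Fin.natAdd h c) 1) (∏ V' ∈ PT.erase (lab a), (C 1 + ∑ a, C ((fun (_ : Fin h) (_ : Finset (Fin h)) => (0 : ℂ)) a V') *
            X (Fin.castAdd h a) + ∑ c, C (γ V' c) * X (Fin.natAdd h c)))) = A := by
    ext i j
    simp only [hA, Matrix.of_apply, hb, hLOO]
  rw [hAeq]
  set ρ : Fin r → Finset (Fin h) → ℂ := fun i X' =>
    if i = i₀ then (if X' = ∅ then 1 else 0) else ∑ a ∈ u i, χ a * tfun (lab a) X' with hρ
  have hAentry : ∀ i j, A i j = ∑ X' ∈ (w j).powerset, b (w j \ X') * ρ i X' := by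
    intro i j
    by_cases hi : i = i₀
    · simp only [hA, hρ, Matrix.of_apply, if_pos hi, mul_ite, mul_one, mul_zero]
      rw [Finset.sum_ite_eq', if_pos (Finset.empty_mem_powerset _), Finset.sdiff_empty]
    · simp only [hA, hρ, Matrix.of_apply, if_neg hi]
      have e1 : ∀ a ∈ u i, χ a * LOO (lab a) j =
          ∑ X' ∈ (w j).powerset, b (w j \ X') * (χ a * tfun (lab a) X') := by
        intro a _
        rw [hLOOt (lab a) j (hlabPT a), Finset.mul_sum]
        refine Finset.sum_congr rfl fun X' _ => ?_
        ring
      rw [Finset.sum_congr rfl e1, Finset.sum_comm]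
      refine Finset.sum_congr rfl fun X' _ => ?_
      rw [Finset.mul_sum]
  have hsuppρ : ∀ i X', ρ i X' ≠ 0 → ∃ i', U i' = X' := by
    intro i X' hX
    by_cases hi : i = i₀
    · simp only [hρ, if_pos hi] at hX
      by_cases h0 : X' = ∅
      · exact ⟨σ i₀, hσ0.trans h0.symm⟩
      · exact absurd (if_neg h0) hX
    · simp only [hρ, if_neg hi] at hX
      obtain ⟨a, -, hne⟩ := Finset.exists_ne_zero_of_sum_ne_zero hX
      have htf : tfun (lab a) X' ≠ 0 := fun e => hne (by rw [e, mul_zero])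
      obtain ⟨k, hk⟩ := hlabU a
      exact hUdown k X' (by rw [← hk]; exact htfun_supp _ _ htf)
  -- the factorisation `A = P · B̃`
  set P : Matrix (Fin r) (Fin r) ℂ := Matrix.of fun i i' => ρ i (U i') with hP
  set Bt : Matrix (Fin r) (Fin r) ℂ := Matrix.of fun i' j => if U i' ⊆ w j then b (w j \ U i') else 0
    with hBtdef
  have hfact : A = P * Bt := by
    ext i j
    rw [hAentry i j, Matrix.mul_apply]
    simp only [hP, hBtdef, Matrix.of_apply, mul_ite, mul_zero]
    have e1 : ∑ i', (if U i' ⊆ w j then ρ i (U i') * b (w j \ U i') else 0) =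
        ∑ X' ∈ (Finset.univ : Finset (Fin r)).image U,
          (if X' ⊆ w j then ρ i X' * b (w j \ X') else 0) := by
      rw [Finset.sum_image (fun i₁ _ i₂ _ e => hUinj e)]
    have e2 : ∑ X' ∈ (Finset.univ : Finset (Fin r)).image U,
          (if X' ⊆ w j then ρ i X' * b (w j \ X') else 0) =
        ∑ X' ∈ ((Finset.univ : Finset (Fin r)).image U).filter (fun X' => X' ⊆ w j),
          ρ i X' * b (w j \ X') := by
      rw [Finset.sum_filter]
    have e3 : ((Finset.univ : Finset (Fin r)).image U).filter (fun X' => X' ⊆ w j) =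
        (w j).powerset.filter (fun X' => ∃ i', U i' = X') := by
      ext X'
      simp only [Finset.mem_filter, Finset.mem_image, Finset.mem_univ, true_and, Finset.mem_powerset]
      exact and_comm
    have e4 : ∑ X' ∈ (w j).powerset.filter (fun X' => ∃ i', U i' = X'), ρ i X' * b (w j \ X') =
        ∑ X' ∈ (w j).powerset, b (w j \ X') * ρ i X' := by
      rw [Finset.sum_filter_of_ne]
      · exact Finset.sum_congr rfl fun X' _ => mul_comm _ _
      · intro X' _ hne
        have hX : ρ i X' ≠ 0 := fun e => hne (by rw [e, zero_mul])
        exact hsuppρ i X' hX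
    rw [e1, e2, e3, e4]
  -- `χ a · t_{lab a}` as a sum over the rows
  have hχsum : ∀ a X', χ a * tfun (lab a) X' =
      ∑ k ∈ (Finset.univ : Finset (Fin r)).erase i₀, (if rep k = a then tfun (U (σ k)) X' else 0) := by
    intro a X'
    by_cases hx : ∃ i, i ≠ i₀ ∧ rep i = a
    · obtain ⟨k₀, hk₀, hk₀a⟩ := hx
      rw [Finset.sum_eq_single k₀]
      · rw [if_pos hk₀a, ← hk₀a, hχrep k₀ hk₀, one_mul, hlabrep k₀ hk₀]
      · intro k hk hkne
        rw [if_neg]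
        intro hka
        exact hkne (hrinj k k₀ (Finset.mem_erase.mp hk).1 hk₀ (hka.trans hk₀a.symm))
      · intro hk₀'
        exact absurd (Finset.mem_erase.mpr ⟨hk₀, Finset.mem_univ _⟩) hk₀'
    · rw [hχ0 a hx, zero_mul]
      symm
      refine Finset.sum_eq_zero fun k hk => ?_
      rw [if_neg]
      intro hka
      exact hx ⟨k, (Finset.mem_erase.mp hk).1, hka⟩
  -- `P` is invertible
  have hPinj : Function.Injective fun v => Matrix.vecMul v P := by
    intro c₁ c₂ hc
    rw [← sub_eq_zero]
    set c := c₁ - c₂ with hcdef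
    have h0 : ∀ i', ∑ i, c i * ρ i (U i') = 0 := by
      intro i'
      have e := congr_fun hc i'
      simp only [Matrix.vecMul, dotProduct, hP, Matrix.of_apply] at e
      simp only [hcdef, Pi.sub_apply, sub_mul, Finset.sum_sub_distrib]
      exact sub_eq_zero.mpr e
    set D : Fin r → ℂ := fun k => if k = i₀ then c i₀ else
      ∑ i ∈ ((Finset.univ : Finset (Fin r)).erase i₀).filter (fun i => rep k ∈ u i), c i with hD
    have hexp : ∀ X', ∑ i, c i * ρ i X' = ∑ k, D k * tfun (U (σ k)) X' := by
      intro X'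
      rw [← Finset.add_sum_erase Finset.univ (fun i => c i * ρ i X') (Finset.mem_univ i₀),
        ← Finset.add_sum_erase Finset.univ (fun k => D k * tfun (U (σ k)) X') (Finset.mem_univ i₀)]
      have e0 : c i₀ * ρ i₀ X' = D i₀ * tfun (U (σ i₀)) X' := by
        simp only [hρ, hD, if_pos rfl, hσ0, htfun_empty]
      have lhs : ∀ i ∈ (Finset.univ : Finset (Fin r)).erase i₀, c i * ρ i X' =
          ∑ k ∈ (Finset.univ : Finset (Fin r)).erase i₀,
            (if rep k ∈ u i then c i * tfun (U (σ k)) X' else 0) := by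
        intro i hi
        have hi0 : i ≠ i₀ := (Finset.mem_erase.mp hi).1
        simp only [hρ, if_neg hi0, Finset.mul_sum]
        have e2 : ∀ a ∈ u i, c i * (χ a * tfun (lab a) X') =
            ∑ k ∈ (Finset.univ : Finset (Fin r)).erase i₀,
              (if rep k = a then c i * tfun (U (σ k)) X' else 0) := by
          intro a _
          rw [hχsum, Finset.mul_sum]
          refine Finset.sum_congr rfl fun k _ => ?_
          split_ifs
          · rfl
          · rw [mul_zero]
        rw [Finset.sum_congr rfl e2, Finset.sum_comm]
        refine Finset.sum_congr rfl fun k _ => ?_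
        rw [Finset.sum_ite_eq]
      have e1 : ∑ i ∈ (Finset.univ : Finset (Fin r)).erase i₀, c i * ρ i X' =
          ∑ k ∈ (Finset.univ : Finset (Fin r)).erase i₀, D k * tfun (U (σ k)) X' := by
        rw [Finset.sum_congr rfl lhs, Finset.sum_comm]
        refine Finset.sum_congr rfl fun k hk => ?_
        have hk0 : k ≠ i₀ := (Finset.mem_erase.mp hk).1
        simp only [hD, if_neg hk0, Finset.sum_mul, Finset.sum_filter]
        refine Finset.sum_congr rfl fun i _ => ?_
        split_ifs
        · rfl
        · rw [zero_mul]
      rw [e0, e1]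
    have hD0 : ∀ k, D k = 0 := by
      refine tinvFamily_eq_zero U hUinj σ γ hγprod D fun i' => ?_
      have e := h0 i'
      rw [hexp] at e
      simpa only [htfun] using e
    have hci₀ : c i₀ = 0 := by
      have e := hD0 i₀
      simp only [hD, if_pos rfl] at e
      exact e
    set R₀ : ℕ := (Finset.univ : Finset (Fin r)).sup (fun i => rank (rep i)) with hR₀
    have hR₀le : ∀ i, rank (rep i) ≤ R₀ := fun i =>
      Finset.le_sup (f := fun i => rank (rep i)) (Finset.mem_univ i)
    have hindK : ∀ n : ℕ, ∀ k, k ≠ i₀ → R₀ - rank (rep k) = n → c k = 0 := by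
      intro n
      induction n using Nat.strong_induction_on with
      | _ n ih =>
        intro k hk hn
        have hDk := hD0 k
        simp only [hD, if_neg hk] at hDk
        have hkmem : k ∈ ((Finset.univ : Finset (Fin r)).erase i₀).filter (fun i => rep k ∈ u i) :=
          Finset.mem_filter.mpr ⟨Finset.mem_erase.mpr ⟨hk, Finset.mem_univ _⟩, hrep k hk⟩
        rw [← Finset.add_sum_erase _ _ hkmem] at hDk
        have hrest : ∑ i ∈ (((Finset.univ : Finset (Fin r)).erase i₀).filter
            (fun i => rep k ∈ u i)).erase k, c i = 0 := by
          refine Finset.sum_eq_zero fun i hi => ?_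
          have hik : i ≠ k := (Finset.mem_erase.mp hi).1
          have hi' := Finset.mem_filter.mp (Finset.mem_erase.mp hi).2
          have hi0 : i ≠ i₀ := (Finset.mem_erase.mp hi'.1).1
          have hrk : rep k ∈ u i := hi'.2
          have hci : (u i).card = 2 := by
            rcases Nat.lt_or_ge (u i).card 2 with hlt | hge
            · exfalso
              have hc1 : (u i).card = 1 := by have := hcard_pos i hi0; omega
              obtain ⟨x, hx⟩ := Finset.card_eq_one.mp hc1
              have e1 : rep i = x := hsingrep i x hi0 hx
              have e2 : rep k = x := Finset.mem_singleton.mp (by rw [← hx]; exact hrk)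
              exact hik (hrinj i k hi0 hk (e1.trans e2.symm))
            · exact le_antisymm (hu2 i) hge
          have hck : (u k).card = 2 := hreppair i k (rep k) hci hrk hk rfl
          have hne : rep k ≠ rep i := fun e => hik (hrinj i k hi0 hk e.symm)
          have hlt := hrank i k hi0 hk hci hck hrk hne
          have hle := hR₀le i
          exact ih (R₀ - rank (rep i)) (by omega) i hi0 rfl
        rw [hrest, add_zero] at hDk
        exact hDk
    funext k
    by_cases hk : k = i₀
    · rw [hk]
      exact hci₀
    · exact hindK _ k hk rfl
  have hPdet : P.det ≠ 0 := by
    have hunit := Matrix.vecMul_injective_iff_isUnit.mp hPinj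
    exact ((Matrix.isUnit_iff_isUnit_det _).mp hunit).ne_zero
  have hBt' : Bt.det ≠ 0 := by
    have e : Bt = Matrix.of fun i j : Fin r => if U i ⊆ w j then
        coeff (∑ a ∈ (∅ : Finset (Fin h)), Finsupp.single (Fin.castAdd h a) 1 +
            ∑ c ∈ w j \ U i, Finsupp.single (Fin.natAdd h c) 1)
          (∏ V ∈ PT, (C 1 + ∑ a, C ((fun (_ : Fin h) (_ : Finset (Fin h)) => (0 : ℂ)) a V) *
            X (Fin.castAdd h a) + ∑ c, C (γ V c) * X (Fin.natAdd h c))) else 0 := by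
      ext i j
      rw [hBtdef, Matrix.of_apply, Matrix.of_apply]
      split_ifs
      · exact hb _
      · rfl
    rw [e]
    exact hBt
  rw [hfact, Matrix.det_mul]
  exact mul_ne_zero hPdet hBt'

end Summit.ValiantsHypothesis.ValiantsHypothesis.Theorems.BarrierLever.ChowThinAll
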